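import Literature.Topology.FourManifolds.KnotsInBall
import Literature.Topology.FourManifolds.KnotsIsotopyProofs
import Literature.Topology.FourManifolds.DehnSurgeryTubularNbhdProofs
import Literature.Topology.FourManifolds.SphereMapsMissPoints
import HarnessLib

/-!
# Every knot is isotopic to one with a flat arc in the stereographic chart

Topic `Literature/Topology/FourManifolds`; a brick of the decomposition of the Fox–Milnor
congruence `Literature.Topology.FourManifolds.Knot.IsConnectedSum.isConcordant` (a band is to be
attached to a straight arc of a small copy of the second factor; this file provides, up to
ambient isotopy, the straight arc). Everything here is proved; the main statement is
`Literature.Topology.FourManifolds.Knot.exists_flatArc`: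

> every knot `K : 𝕊¹ ↪ 𝕊³` is ambient isotopic to a knot `K'` off the south pole such that, in
> the stereographic chart `ψ` (`KnotsInBall.psi`), `ψ ∘ K'` contains a straight segment
> `{p + s e : |s| ≤ ℓ}` (`e` a horizontal unit vector), lies entirely at height `≥ p₂`, meets the
> box `{|⟪z - p, e⟫| < ℓ, z₂ < p₂ + ν}` only along the segment, and traverses the segment with
> nonzero speed.

Construction (Hirsch, *Differential Topology*, Ch. 8 §1: isotopies from flows of cut-off
vector fields):

* `Knot.exists_isIsotopic_forall_ne` — move the knot off the south pole by a diffeomorphism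
  diffeotopic to the identity (`Diffeomorph.exists_isDiffeotopicToId_apply_eq_of_connectedSpace`,
  `Homogeneity.lean`), so that the chart curve `Knot.chartCurve K θ = ψ (K (cos θ, sin θ))` is a
  `C^∞` regular `2π`-periodic curve in `ℝ³` identifying exactly the period translates.
* `Knot.ArcFrame` — at a **lowest point** `θ₀` of the chart curve the tangent `e` is horizontal
  and the tangent coordinate `σ θ = ⟪chartCurve θ - p, e⟫` is a local diffeomorphism (inverse
  function theorem, `ContDiffAt.toOpenPartialHomeomorph`); on a window the curve is the graph
  `p + σ • e + g ∘ σ` of a function `g ⊥ e` of nonnegative height (`chartCurve_eq`,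
  `g_two_nonneg`).
* `Knot.ArcFrame.Scales` — the far strands keep a distance `b > 0` from the graph
  (`exists_sep`, compactness and injectivity), and `‖g‖ ≤ b/8` on `|s| ≤ a`.
* The **flattening field** `Y z = χ (s z) ψ (‖ŷ z‖²) • (-(b/8) e₂ - ĝ (s z))` (cut-offs `χ` in the
  tangent coordinate, `ψ` in the squared distance `‖ŷ‖²` to the smoothed graph `ĝ = χ₂ g`): the
  knot points move on straight segments `curve θ t = chartCurve θ + t μ θ • V̂ (σ θ)` solving
  `u' = Y u` (`hasDerivAt_curve`), the far strands and the ends of the window not at all; the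
  segments stay in a compact set; `exists_ambientIsotopy_of_hasDerivAt` (`KnotsInBall.lean`)
  integrates, `AmbientIsotopy.alongChart` transports to `𝕊³` (`exists_knot`).
* End points: on `|σ| ≤ a/4` the arc lands on the line `p̂ + σ e`, `p̂ = p - (b/8) e₂`
  (`curve_one_eq`); all end points have height `≥ p̂₂` (`pHat_two_le_curve_one`); the box below
  height `p₂` is met only by the segment (`curve_one_eq_of_lt`).

## References

* M. W. Hirsch, *Differential Topology*, GTM 33 (1976), Ch. 8 §1, Thms. 1.3–1.4 (extension of
  isotopies by flows of compactly supported time-dependent fields). [HirschDT1976]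
* R. H. Crowell, R. H. Fox, *Introduction to Knot Theory* (1963), Ch. I §2 (local modifications
  of differentiable knots). [CrowellFox1963]

## Design notes

* The chart is the fixed stereographic chart `KnotsInBall.psi` from the south pole; general
  position of the knot with respect to the pole is restored by homogeneity rather than by
  changing the chart, so that the whole `psi` interface of `KnotsInBall.lean` applies.
* `ArcFrame`/`Scales` carry the chosen data (parameters, radii, the local inverse) as
  `Type`-valued structures with `Nonempty` existence theorems; all estimates are explicit.
  No named facts, no `sorry`; `𝔼 n`, `𝕊 n` are local notation as in `Knots.lean`.
-/

open scoped Manifold ContDiff Topology RealInnerProductSpace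
open Function Set Metric

noncomputable section

namespace Literature.Topology.FourManifolds

/-- Local notation: `𝔼 n` is the model Euclidean space `EuclideanSpace ℝ (Fin n)`. -/
local notation "𝔼 " n:arg => EuclideanSpace ℝ (Fin n)

/-- Local notation: `𝕊 n` is the unit sphere in `EuclideanSpace ℝ (Fin (n + 1))`. -/
local notation "𝕊 " n:arg => (Metric.sphere (0 : EuclideanSpace ℝ (Fin (n + 1))) 1)

attribute [local instance] fact_finrank_euclideanSpace_succ

open KnotsInBall

/-! ### Moving a knot off a point -/

namespace SphereEmbedding

variable {k n : ℕ}

/-- The image of a sphere embedding under a diffeomorphism diffeotopic to the identity is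
ambient isotopic to it. [folklore] -/
theorem isIsotopic_map_of_isDiffeotopicToId (K : SphereEmbedding k n) {P : 𝕊 n ≃ₘ⟮𝓡 n, 𝓡 n⟯ 𝕊 n}
    (hP : Diffeomorph.IsDiffeotopicToId P) : K.IsIsotopic (K.map P) := by
  obtain ⟨D, hD⟩ := hP
  refine ⟨D.toAmbientIsotopy, ?_⟩
  funext x
  change D.toAmbientIsotopy.toFun 1 (K x) = P (K x)
  rw [← hD, Diffeotopy.coe_stage]
  rfl

end SphereEmbedding

namespace Knot

/-- The round `3`-sphere is connected. [folklore] -/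
theorem connectedSpace_sphereThree : ConnectedSpace (𝕊 3) := by
  refine isConnected_iff_connectedSpace.mp (isConnected_sphere ?_ 0 zero_le_one)
  rw [← Module.finrank_eq_rank, finrank_euclideanSpace_fin]
  norm_num

/-- **A knot can be isotoped off any given point** (by a diffeomorphism diffeotopic to the
identity which moves a point of the complement to the given point; homogeneity,
`Diffeomorph.exists_isDiffeotopicToId_apply_eq_of_connectedSpace`). [folklore] -/
theorem exists_isIsotopic_forall_ne (K : Knot) (q : 𝕊 3) :
    ∃ K' : Knot, K.IsIsotopic K' ∧ ∀ x, K' x ≠ q := by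
  haveI := connectedSpace_sphereThree
  obtain ⟨y, hy⟩ := SphereEmbedding.exists_notMem_range (by norm_num) K
  obtain ⟨P, hP, hPy⟩ := Diffeomorph.exists_isDiffeotopicToId_apply_eq_of_connectedSpace
    (E := 𝔼 3) (M := 𝕊 3) y q
  refine ⟨K.map P, K.isIsotopic_map_of_isDiffeotopicToId hP, fun x hx ↦ hy ⟨x, ?_⟩⟩
  change P (K x) = q at hx
  rw [← hPy] at hx
  exact P.injective hx

/-! ### The knot read in the stereographic chart -/

variable (K : Knot)

/-- The knot read in the stereographic chart `psi` from the south pole, as a `2π`-periodic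
curve `θ ↦ ψ (K (cos θ, sin θ))` in `ℝ³`. [folklore] -/
def chartCurve (θ : ℝ) : 𝔼 3 :=
  psi (K (circlePoint θ))

/-- Pointwise formula. [folklore] -/
theorem chartCurve_apply (θ : ℝ) : K.chartCurve θ = psi (K (circlePoint θ)) := rfl

/-- The chart curve is `2π`-periodic. [folklore] -/
theorem periodic_chartCurve : Periodic K.chartCurve (2 * Real.pi) := fun θ ↦ by
  simp [chartCurve, periodic_circlePoint θ]

variable {K}

/-- Back through the chart: `ψ⁻¹ (chartCurve θ) = K (circlePoint θ)` for a knot off the south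
pole. [folklore] -/
theorem psi_symm_chartCurve (hK : ∀ x, K x ≠ southPole) (θ : ℝ) :
    psi.symm (K.chartCurve θ) = K (circlePoint θ) :=
  psi_symm_apply_psi (hK _)

/-- The knot read in the chart, as a map on the circle, is smooth. [folklore] -/
theorem contMDiff_psi_comp (hK : ∀ x, K x ≠ southPole) :
    ContMDiff (𝓡 1) 𝓘(ℝ, 𝔼 3) ∞ fun x : 𝕊 1 ↦ psi (K x) := by
  have h1 : ContMDiff (𝓡 1) (𝓡 3) ∞ fun x : 𝕊 1 ↦ psi (K x) :=
    contMDiffOn_psi.comp_contMDiff K.contMDiff fun x ↦ mem_psi_source (hK x)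
  exact h1

/-- The chart curve of a knot off the south pole is `C^∞`. [folklore] -/
theorem contDiff_chartCurve (hK : ∀ x, K x ≠ southPole) : ContDiff ℝ ∞ K.chartCurve := by
  have h := (contMDiff_psi_comp hK).comp contMDiff_circlePoint
  rw [contMDiff_iff_contDiff] at h
  exact h

/-- The curve of the knot in `ℝ⁴` factors through the chart curve:
`K.curve = (↑) ∘ ψ⁻¹ ∘ chartCurve`. [folklore] -/
theorem curve_eq_comp_chartCurve (hK : ∀ x, K x ≠ southPole) :
    SphereEmbedding.curve K = (fun w : 𝔼 3 ↦ ((psi.symm w : 𝕊 3) : 𝔼 4)) ∘ K.chartCurve := by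
  funext θ
  rw [comp_apply, psi_symm_chartCurve hK, SphereEmbedding.curve_apply]

/-- The inverse chart followed by the inclusion `𝕊³ ⊆ ℝ⁴` is `C^∞` on `ℝ³`. [folklore] -/
theorem contDiff_coe_psi_symm : ContDiff ℝ ∞ fun w : 𝔼 3 ↦ ((psi.symm w : 𝕊 3) : 𝔼 4) := by
  have h : ContMDiff (𝓡 3) 𝓘(ℝ, 𝔼 4) ∞ fun w : 𝔼 3 ↦ ((psi.symm w : 𝕊 3) : 𝔼 4) :=
    contMDiff_coe_sphere.comp contMDiff_psi_symm
  rw [contMDiff_iff_contDiff] at h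
  exact h

/-- **The chart curve is regular.** [folklore] -/
theorem deriv_chartCurve_ne_zero (hK : ∀ x, K x ≠ southPole) (θ : ℝ) :
    deriv K.chartCurve θ ≠ 0 := by
  intro h0
  have h1 : deriv (SphereEmbedding.curve K) θ =
      fderiv ℝ (fun w : 𝔼 3 ↦ ((psi.symm w : 𝕊 3) : 𝔼 4)) (K.chartCurve θ)
        (deriv K.chartCurve θ) := by
    rw [curve_eq_comp_chartCurve hK]
    exact fderiv_comp_deriv θ ((contDiff_coe_psi_symm.differentiable (by simp)) _)
      (((contDiff_chartCurve hK).differentiable (by simp)) θ)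
  rw [h0, map_zero] at h1
  exact SphereEmbedding.tangent_ne_zero K θ h1

/-- **The chart curve identifies exactly the period translates.** [folklore] -/
theorem chartCurve_eq_iff (hK : ∀ x, K x ≠ southPole) {s t : ℝ} :
    K.chartCurve s = K.chartCurve t ↔ circlePoint s = circlePoint t := by
  constructor
  · intro h
    have h1 : K (circlePoint s) = K (circlePoint t) := by
      rw [← psi_symm_chartCurve hK s, ← psi_symm_chartCurve hK t, h]
    exact K.injective h1
  · intro h
    rw [chartCurve_apply, chartCurve_apply, h]

/-- The chart curve is continuous. [folklore] -/
theorem continuous_chartCurve (hK : ∀ x, K x ≠ southPole) : Continuous K.chartCurve :=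
  (contDiff_chartCurve hK).continuous

/-- **A lowest point**: the height `(chartCurve θ)₂` attains its minimum. [folklore] -/
theorem exists_forall_chartCurve_le (hK : ∀ x, K x ≠ southPole) :
    ∃ θ₀ : ℝ, ∀ θ, K.chartCurve θ₀ 2 ≤ K.chartCurve θ 2 := by
  have hc : Continuous fun θ ↦ K.chartCurve θ 2 :=
    (EuclideanSpace.proj (2 : Fin 3)).continuous.comp (continuous_chartCurve hK)
  obtain ⟨θ₀, -, hmin⟩ := (isCompact_Icc (a := (0 : ℝ)) (b := 2 * Real.pi)).exists_isMinOn
    (nonempty_Icc.2 (by positivity)) hc.continuousOn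
  refine ⟨θ₀, fun θ ↦ ?_⟩
  -- reduce `θ` into the period window
  obtain ⟨m, hm⟩ : ∃ m : ℤ, θ - m * (2 * Real.pi) ∈ Icc (0 : ℝ) (2 * Real.pi) := by
    refine ⟨⌊θ / (2 * Real.pi)⌋, ?_, ?_⟩
    · have := Int.floor_le (θ / (2 * Real.pi))
      have h2 : (0 : ℝ) < 2 * Real.pi := by positivity
      rw [le_div_iff₀ h2] at this
      linarith
    · have := Int.lt_floor_add_one (θ / (2 * Real.pi))
      have h2 : (0 : ℝ) < 2 * Real.pi := by positivity
      rw [div_lt_iff₀ h2] at this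
      nlinarith
  have hper : K.chartCurve (θ - m * (2 * Real.pi)) = K.chartCurve θ := by
    have := (K.periodic_chartCurve.int_mul (-m)) θ
    rw [← this]
    congr 1
    push_cast
    ring
  have := hmin hm
  simp only [mem_setOf_eq] at this
  rw [hper] at this
  exact this

/-! ### Coordinates adapted to the lowest point -/

variable (K)

/-- The base point `p = chartCurve θ₀`. [folklore] -/
def basePt (θ₀ : ℝ) : 𝔼 3 := K.chartCurve θ₀

/-- The unit tangent `e = v / ‖v‖`, `v = chartCurve' θ₀`. [folklore] -/
def unitTan (θ₀ : ℝ) : 𝔼 3 := ‖deriv K.chartCurve θ₀‖⁻¹ • deriv K.chartCurve θ₀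

/-- The coordinate along the tangent: `σ θ = ⟪chartCurve θ - p, e⟫`. [folklore] -/
def sCoord (θ₀ θ : ℝ) : ℝ := ⟪K.chartCurve θ - K.basePt θ₀, K.unitTan θ₀⟫

variable {K}

/-- The unit tangent is a unit vector. [folklore] -/
theorem norm_unitTan (hK : ∀ x, K x ≠ southPole) (θ₀ : ℝ) : ‖K.unitTan θ₀‖ = 1 := by
  rw [unitTan, norm_smul, norm_inv, norm_norm,
    inv_mul_cancel₀ (norm_ne_zero_iff.2 (deriv_chartCurve_ne_zero hK θ₀))]

/-- The velocity of the height `(chartCurve θ)₂`. [folklore] -/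
theorem hasDerivAt_chartCurve_two (hK : ∀ x, K x ≠ southPole) (θ : ℝ) :
    HasDerivAt (fun θ ↦ K.chartCurve θ 2) (deriv K.chartCurve θ 2) θ := by
  have h := (((contDiff_chartCurve hK).differentiable (by simp)) θ).hasDerivAt
  exact ((EuclideanSpace.proj (2 : Fin 3)).hasFDerivAt.comp_hasDerivAt θ h)

/-- **At a lowest point the tangent is horizontal**: `e₂ = 0`. [folklore] -/
theorem unitTan_two (hK : ∀ x, K x ≠ southPole) {θ₀ : ℝ}
    (hmin : ∀ θ, K.chartCurve θ₀ 2 ≤ K.chartCurve θ 2) : K.unitTan θ₀ 2 = 0 := by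
  have hloc : IsLocalMin (fun θ ↦ K.chartCurve θ 2) θ₀ :=
    Filter.Eventually.of_forall fun θ ↦ hmin θ
  have h0 : deriv K.chartCurve θ₀ 2 = 0 := by
    rw [← (hasDerivAt_chartCurve_two hK θ₀).deriv]
    exact hloc.deriv_eq_zero
  simp [unitTan, h0]

/-- The tangent coordinate is `C^∞`. [folklore] -/
theorem contDiff_sCoord (hK : ∀ x, K x ≠ southPole) (θ₀ : ℝ) : ContDiff ℝ ∞ (K.sCoord θ₀) :=
  ((contDiff_chartCurve hK).sub contDiff_const).inner ℝ contDiff_const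

/-- The velocity of the tangent coordinate. [folklore] -/
theorem hasDerivAt_sCoord (hK : ∀ x, K x ≠ southPole) (θ₀ θ : ℝ) :
    HasDerivAt (K.sCoord θ₀) ⟪deriv K.chartCurve θ, K.unitTan θ₀⟫ θ := by
  have h := (((contDiff_chartCurve hK).differentiable (by simp)) θ).hasDerivAt
  have h2 := (innerSL ℝ (K.unitTan θ₀)).hasFDerivAt.comp_hasDerivAt θ (h.sub_const (K.basePt θ₀))
  have hfun : (⇑(innerSL ℝ (K.unitTan θ₀)) ∘ fun t ↦ K.chartCurve t - K.basePt θ₀) = K.sCoord θ₀ := by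
    funext t
    simp [sCoord, real_inner_comm]
  rw [hfun] at h2
  simpa [real_inner_comm] using h2

/-- At the base point the tangent coordinate has velocity `‖v‖ > 0`. [folklore] -/
theorem deriv_sCoord_self (hK : ∀ x, K x ≠ southPole) (θ₀ : ℝ) :
    deriv (K.sCoord θ₀) θ₀ = ‖deriv K.chartCurve θ₀‖ := by
  rw [(hasDerivAt_sCoord hK θ₀ θ₀).deriv, unitTan, real_inner_smul_right,
    real_inner_self_eq_norm_sq]
  have := norm_ne_zero_iff.2 (deriv_chartCurve_ne_zero hK θ₀)
  field_simp

/-- The tangent coordinate vanishes at the base point. [folklore] -/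
theorem sCoord_self (θ₀ : ℝ) : K.sCoord θ₀ θ₀ = 0 := by
  simp [sCoord, basePt]

/-- The tangent coordinate is `2π`-periodic. [folklore] -/
theorem periodic_sCoord (θ₀ : ℝ) : Periodic (K.sCoord θ₀) (2 * Real.pi) := fun θ ↦ by
  simp only [sCoord, K.periodic_chartCurve θ]

/-! ### The window and the local inverse of the tangent coordinate -/

variable (K) in
/-- **Frame data of a flat arc construction** at a lowest point `θ₀` of a knot off the south
pole: a window `(θ₀ - w, θ₀ + w)` on which the tangent coordinate `σ` is a diffeomorphism onto a
neighbourhood of `0 ∈ ℝ` containing `(-r, r)`, with local inverse `τ`. [folklore] -/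
structure ArcFrame where
  /-- The parameter of the lowest point. -/
  θ₀ : ℝ
  /-- The half-width of the window. -/
  w : ℝ
  /-- The radius in the tangent coordinate. -/
  r : ℝ
  /-- The local inverse of the tangent coordinate. -/
  τ : ℝ → ℝ
  ne_southPole : ∀ x, K x ≠ southPole
  isMin : ∀ θ, K.chartCurve θ₀ 2 ≤ K.chartCurve θ 2
  w_pos : 0 < w
  w_le : w ≤ 1
  r_pos : 0 < r
  deriv_pos : ∀ θ ∈ Ioo (θ₀ - w) (θ₀ + w), 0 < deriv (K.sCoord θ₀) θ
  τ_mem : ∀ s, |s| < r → τ s ∈ Ioo (θ₀ - w) (θ₀ + w)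
  sCoord_τ : ∀ s, |s| < r → K.sCoord θ₀ (τ s) = s
  τ_sCoord : ∀ θ ∈ Ioo (θ₀ - w) (θ₀ + w), τ (K.sCoord θ₀ θ) = θ
  contDiffAt_τ : ∀ s, |s| < r → ContDiffAt ℝ ∞ τ s

/-- **Frame data exist** for every knot off the south pole (inverse function theorem for the
tangent coordinate at a lowest point). [folklore] -/
theorem nonempty_arcFrame (hK : ∀ x, K x ≠ southPole) : Nonempty (ArcFrame K) := by
  obtain ⟨θ₀, hmin⟩ := exists_forall_chartCurve_le hK
  set σ := K.sCoord θ₀ with hσdef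
  have hσ : ContDiff ℝ ∞ σ := contDiff_sCoord hK θ₀
  have hd0 : deriv σ θ₀ ≠ 0 := by
    rw [hσdef, deriv_sCoord_self hK]
    exact norm_ne_zero_iff.2 (deriv_chartCurve_ne_zero hK θ₀)
  have hσd : ∀ θ, HasDerivAt σ (deriv σ θ) θ := fun θ ↦
    ((hσ.differentiable (by simp)) θ).hasDerivAt
  -- the inverse function theorem at `θ₀`
  set eσ := hσ.contDiffAt.toOpenPartialHomeomorph σ ((hσd θ₀).hasFDerivAt_equiv hd0)
    (by simp) with heσ
  have hcoe : (eσ : ℝ → ℝ) = σ := hσ.contDiffAt.toOpenPartialHomeomorph_coe _ _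
  have hsrc : θ₀ ∈ eσ.source := hσ.contDiffAt.mem_toOpenPartialHomeomorph_source _ _
  have htgt : σ θ₀ ∈ eσ.target := hσ.contDiffAt.image_mem_toOpenPartialHomeomorph_target _ _
  have hσ0 : σ θ₀ = 0 := sCoord_self θ₀
  -- the window: inside the source and where `σ' > 0`
  have hpos : ∀ᶠ θ in 𝓝 θ₀, 0 < deriv σ θ := by
    have hc : Continuous (deriv σ) := hσ.continuous_deriv (by simp)
    have h0 : 0 < deriv σ θ₀ := by
      rw [hσdef, deriv_sCoord_self hK]
      exact norm_pos_iff.2 (deriv_chartCurve_ne_zero hK θ₀)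
    exact hc.continuousAt.eventually (Ioi_mem_nhds h0)
  obtain ⟨w₁, hw₁, hw₁sub⟩ : ∃ w₁ > 0, ball θ₀ w₁ ⊆ eσ.source ∩ {θ | 0 < deriv σ θ} :=
    Metric.mem_nhds_iff.1 (Filter.inter_mem (eσ.open_source.mem_nhds hsrc) hpos)
  set w := min w₁ 1 with hw
  have hw0 : 0 < w := lt_min hw₁ one_pos
  have hwin : Ioo (θ₀ - w) (θ₀ + w) ⊆ eσ.source ∩ {θ | 0 < deriv σ θ} := by
    intro θ hθ
    apply hw₁sub
    rw [mem_ball, Real.dist_eq, abs_lt]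
    constructor <;> linarith [hθ.1, hθ.2, min_le_left w₁ 1]
  -- the radius: `τ` continuous at `0` with `τ 0 = θ₀`
  set τ := (eσ.symm : ℝ → ℝ) with hτ
  have hτ0 : τ 0 = θ₀ := by
    rw [← hσ0, hτ, ← hcoe]
    exact eσ.left_inv hsrc
  have htgt0 : (0 : ℝ) ∈ eσ.target := hσ0 ▸ htgt
  have hτc : ContinuousAt τ 0 := eσ.continuousAt_symm htgt0
  obtain ⟨r, hr, hrsub⟩ : ∃ r > 0, ball (0 : ℝ) r ⊆ eσ.target ∩ τ ⁻¹' Ioo (θ₀ - w) (θ₀ + w) := by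
    refine Metric.mem_nhds_iff.1 (Filter.inter_mem (eσ.open_target.mem_nhds htgt0) ?_)
    apply hτc.preimage_mem_nhds
    rw [hτ0]
    exact Ioo_mem_nhds (by linarith) (by linarith)
  have hball : ∀ s : ℝ, |s| < r → s ∈ ball (0 : ℝ) r := fun s hs ↦ by
    rwa [mem_ball, dist_zero_right, Real.norm_eq_abs]
  refine ⟨⟨θ₀, w, r, τ, hK, hmin, hw0, min_le_right _ _, hr, fun θ hθ ↦ (hwin hθ).2,
    fun s hs ↦ (hrsub (hball s hs)).2, fun s hs ↦ ?_, fun θ hθ ↦ ?_, fun s hs ↦ ?_⟩⟩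
  · -- right inverse on the target
    have := eσ.right_inv (hrsub (hball s hs)).1
    rwa [hcoe] at this
  · -- left inverse on the source
    have := eσ.left_inv (hwin hθ).1
    rwa [hcoe] at this
  · -- smoothness of the inverse
    have hs' := hrsub (hball s hs)
    have hθ' : τ s ∈ Ioo (θ₀ - w) (θ₀ + w) := hs'.2
    have hd : deriv σ (τ s) ≠ 0 := ((hwin hθ').2).ne'
    have hder : HasFDerivAt eσ
        (ContinuousLinearEquiv.unitsEquivAut ℝ (Units.mk0 _ hd) : ℝ →L[ℝ] ℝ) (eσ.symm s) := by
      rw [hcoe]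
      exact (hσd _).hasFDerivAt_equiv hd
    exact eσ.contDiffAt_symm hs'.1 hder (by rw [hcoe]; exact hσ.contDiffAt)

namespace ArcFrame

variable (A : ArcFrame K)

/-- The base point of the frame. [folklore] -/
def p : 𝔼 3 := K.basePt A.θ₀

/-- The unit tangent of the frame. [folklore] -/
def e : 𝔼 3 := K.unitTan A.θ₀

/-- The tangent coordinate of the frame. [folklore] -/
def σ (θ : ℝ) : ℝ := K.sCoord A.θ₀ θ

/-- The unit tangent is a unit vector. [folklore] -/
theorem norm_e : ‖A.e‖ = 1 := norm_unitTan A.ne_southPole _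

/-- The unit tangent is horizontal. [folklore] -/
theorem e_two : A.e 2 = 0 := unitTan_two A.ne_southPole A.isMin

/-- `⟪e, e⟫ = 1`. [folklore] -/
theorem inner_e_e : ⟪A.e, A.e⟫ = 1 := by
  rw [real_inner_self_eq_norm_sq, A.norm_e, one_pow]

/-- The tangent coordinate, unfolded. [folklore] -/
theorem σ_apply (θ : ℝ) : A.σ θ = ⟪K.chartCurve θ - A.p, A.e⟫ := rfl

/-- **The graph function**: `g s = chartCurve (τ s) - p - s • e`, the deviation of the arc from
its tangent line, as a function of the tangent coordinate. [folklore] -/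
def g (s : ℝ) : 𝔼 3 := K.chartCurve (A.τ s) - A.p - s • A.e

/-- **The arc is a graph over its tangent line**: on the window,
`chartCurve θ = p + σ θ • e + g (σ θ)`. [folklore] -/
theorem chartCurve_eq {θ : ℝ} (hθ : θ ∈ Ioo (A.θ₀ - A.w) (A.θ₀ + A.w)) :
    K.chartCurve θ = A.p + A.σ θ • A.e + A.g (A.σ θ) := by
  rw [g, σ, A.τ_sCoord θ hθ]
  abel

/-- The graph function is orthogonal to the tangent (for `|s| < r`). [folklore] -/
theorem inner_g_e {s : ℝ} (hs : |s| < A.r) : ⟪A.g s, A.e⟫ = 0 := by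
  have h := A.sCoord_τ s hs
  rw [g, inner_sub_left, inner_smul_left]
  change K.sCoord A.θ₀ (A.τ s) - _ = 0
  rw [h, A.inner_e_e]
  simp

/-- The graph function vanishes at `0`. [folklore] -/
theorem g_zero : A.g 0 = 0 := by
  rw [g, zero_smul, sub_zero]
  have : A.τ 0 = A.θ₀ := by
    have h := A.τ_sCoord A.θ₀ ⟨by linarith [A.w_pos], by linarith [A.w_pos]⟩
    rwa [sCoord_self] at h
  rw [this]
  exact sub_self _

/-- **The graph function has nonnegative height** (the base point is lowest and `e` is
horizontal). [folklore] -/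
theorem g_two_nonneg (s : ℝ) : 0 ≤ A.g s 2 := by
  have h := A.isMin (A.τ s)
  have : A.g s 2 = K.chartCurve (A.τ s) 2 - K.chartCurve A.θ₀ 2 := by
    simp [g, p, basePt, A.e_two]
  rw [this]
  linarith

/-- The graph function is smooth on `(-r, r)` (pointwise form). [folklore] -/
theorem contDiffAt_g {s : ℝ} (hs : |s| < A.r) : ContDiffAt ℝ ∞ A.g s :=
  (((contDiff_chartCurve A.ne_southPole).contDiffAt.comp s (A.contDiffAt_τ s hs)).sub
    contDiffAt_const).sub (contDiffAt_id.smul contDiffAt_const)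

/-- The graph function is continuous at `0`. [folklore] -/
theorem continuousAt_g_zero : ContinuousAt A.g 0 :=
  (A.contDiffAt_g (by rw [abs_zero]; exact A.r_pos)).continuousAt

/-- The deviation of a point of the knot from the graph: `chartCurve θ - p - σ θ • e - g (σ θ)`
(zero on the window). [folklore] -/
def dev (θ : ℝ) : 𝔼 3 := K.chartCurve θ - A.p - A.σ θ • A.e - A.g (A.σ θ)

/-- `p + s • e + g s = chartCurve (τ s)`. [folklore] -/
theorem p_add (s : ℝ) : A.p + s • A.e + A.g s = K.chartCurve (A.τ s) := by
  rw [g]; abel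

/-- On the window the deviation vanishes. [folklore] -/
theorem dev_eq_zero {θ : ℝ} (hθ : θ ∈ Ioo (A.θ₀ - A.w) (A.θ₀ + A.w)) : A.dev θ = 0 := by
  rw [dev, A.chartCurve_eq hθ]
  abel

/-- **Separation of the far strands from the graph**: off the window (within one period) and
within tangent coordinate `r/2`, the knot keeps a positive distance `b` from the graph.
[folklore] -/
theorem exists_sep : ∃ b : ℝ, 0 < b ∧ ∀ θ ∈ Icc (A.θ₀ + A.w) (A.θ₀ + 2 * Real.pi - A.w),
    |A.σ θ| ≤ A.r / 2 → b ≤ ‖A.dev θ‖ := by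
  set S : Set ℝ := {θ ∈ Icc (A.θ₀ + A.w) (A.θ₀ + 2 * Real.pi - A.w) | |A.σ θ| ≤ A.r / 2} with hS
  have hσc : Continuous A.σ := (contDiff_sCoord A.ne_southPole A.θ₀).continuous
  have hSc : IsCompact S := by
    refine isCompact_Icc.of_isClosed_subset (isClosed_Icc.inter ?_) (fun θ hθ ↦ hθ.1)
    exact isClosed_le (continuous_abs.comp hσc) continuous_const
  -- the deviation is continuous on `S`
  have hcont : ContinuousOn (fun θ ↦ ‖A.dev θ‖) S := by
    refine (ContinuousOn.norm ?_)
    intro θ hθ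
    have hs : |A.σ θ| < A.r := lt_of_le_of_lt hθ.2 (by linarith [A.r_pos])
    have h1 : ContinuousAt (fun θ ↦ A.g (A.σ θ)) θ :=
      ContinuousAt.comp (f := A.σ) (g := A.g) (A.contDiffAt_g hs).continuousAt hσc.continuousAt
    exact ((((continuous_chartCurve A.ne_southPole).continuousAt.sub continuousAt_const).sub
      (hσc.continuousAt.smul continuousAt_const)).sub h1).continuousWithinAt
  by_cases hne : S.Nonempty
  · obtain ⟨θ₁, hθ₁, hmin⟩ := hSc.exists_isMinOn hne hcont
    refine ⟨‖A.dev θ₁‖, ?_, fun θ hθ hσ ↦ ?_⟩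
    · -- the minimum is positive: otherwise `θ₁` would be a window parameter
      rw [norm_pos_iff]
      intro h0
      have hs : |A.σ θ₁| < A.r := lt_of_le_of_lt hθ₁.2 (by linarith [A.r_pos])
      have heq : K.chartCurve θ₁ = K.chartCurve (A.τ (A.σ θ₁)) := by
        rw [← A.p_add]
        rw [dev] at h0
        have := sub_eq_zero.1 (show K.chartCurve θ₁ - (A.p + A.σ θ₁ • A.e + A.g (A.σ θ₁)) = 0 by
          rw [← h0]; abel)
        exact this
      rw [chartCurve_eq_iff A.ne_southPole] at heq
      obtain ⟨m, hm⟩ := exists_eq_add_of_circlePoint_eq heq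
      have hτ := A.τ_mem _ hs
      -- `θ₁ - τ (σ θ₁) ∈ (0, 2π)` cannot be a multiple of `2π`
      have h1 : (0 : ℝ) < m * (2 * Real.pi) := by nlinarith [hθ₁.1.1, hτ.2, Real.pi_pos]
      have h2 : m * (2 * Real.pi) < 2 * Real.pi := by nlinarith [hθ₁.1.2, hτ.1, Real.pi_pos]
      have hm1 : (0 : ℝ) < m := by nlinarith [Real.pi_pos]
      have hm2 : (m : ℝ) < 1 := by nlinarith [Real.pi_pos]
      have : (0 : ℤ) < m := by exact_mod_cast hm1
      have : m < (1 : ℤ) := by exact_mod_cast hm2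
      omega
    · have := hmin ⟨hθ, hσ⟩
      simpa only [mem_setOf_eq] using this
  · refine ⟨1, one_pos, fun θ hθ hσ ↦ (hne ⟨θ, hθ, hσ⟩).elim⟩

/-- **Scales of a flat arc construction**: the tangent half-length `a` and the separation `b`.
[folklore] -/
structure Scales where
  /-- The half-length of the arc in the tangent coordinate. -/
  a : ℝ
  /-- The separation of the far strands from the graph. -/
  b : ℝ
  a_pos : 0 < a
  a_le : a ≤ A.r / 2
  b_pos : 0 < b
  g_small : ∀ s, |s| ≤ a → ‖A.g s‖ ≤ b / 8
  sep : ∀ θ ∈ Icc (A.θ₀ + A.w) (A.θ₀ + 2 * Real.pi - A.w), |A.σ θ| ≤ A.r / 2 → b ≤ ‖A.dev θ‖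

/-- Scales exist. [folklore] -/
theorem nonempty_scales : Nonempty A.Scales := by
  obtain ⟨b, hb, hsep⟩ := A.exists_sep
  have hg : ∀ᶠ s in 𝓝 (0 : ℝ), ‖A.g s‖ < b / 8 := by
    have h := A.continuousAt_g_zero
    rw [ContinuousAt, A.g_zero] at h
    have : ∀ᶠ s in 𝓝 (0 : ℝ), A.g s ∈ ball (0 : 𝔼 3) (b / 8) := h (ball_mem_nhds _ (by linarith))
    filter_upwards [this] with s hs
    rwa [mem_ball, dist_zero_right] at hs
  obtain ⟨a₁, ha₁, ha₁sub⟩ := Metric.mem_nhds_iff.1 hg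
  refine ⟨⟨min (a₁ / 2) (A.r / 2), b, lt_min (by linarith) (by linarith [A.r_pos]),
    min_le_right _ _, hb, fun s hs ↦ ?_, hsep⟩⟩
  have : s ∈ ball (0 : ℝ) a₁ := by
    rw [mem_ball, dist_zero_right, Real.norm_eq_abs]
    linarith [min_le_left (a₁ / 2) (A.r / 2)]
  exact (le_of_lt (ha₁sub this))

/-- The tangent coordinate of a point of `ℝ³`: `⟪z - p, e⟫`. [folklore] -/
def sOf (z : 𝔼 3) : ℝ := ⟪z - A.p, A.e⟫

/-- The tangent coordinate of a point is `C^∞`. [folklore] -/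
theorem contDiff_sOf : ContDiff ℝ ∞ A.sOf := (contDiff_id.sub contDiff_const).inner ℝ contDiff_const

/-- The tangent coordinate of a knot point is `σ`. [folklore] -/
theorem sOf_chartCurve (θ : ℝ) : A.sOf (K.chartCurve θ) = A.σ θ := rfl

/-! ### The flattening field -/

namespace Scales

variable {A} (S : A.Scales)

/-- The cut-off in the tangent coordinate: `1` on `|s| ≤ a/4`, `0` on `|s| ≥ a/2`. [folklore] -/
def χ : ContDiffBump (0 : ℝ) := ⟨S.a / 4, S.a / 2, by linarith [S.a_pos], by linarith [S.a_pos]⟩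

/-- The wider cut-off: `1` on `|s| ≤ a/2`, `0` on `|s| ≥ 3a/4`. [folklore] -/
def χ₂ : ContDiffBump (0 : ℝ) := ⟨S.a / 2, 3 * S.a / 4, by linarith [S.a_pos], by linarith [S.a_pos]⟩

/-- The radial cut-off (argument: squared distance to the graph): `1` up to `(b/2)²`, `0` from
`(3b/4)²`. [folklore] -/
def ψ : ContDiffBump (0 : ℝ) :=
  ⟨(S.b / 2) ^ 2, (3 * S.b / 4) ^ 2, by have := S.b_pos; positivity,
    by nlinarith [S.b_pos]⟩

/-- Values of a bump on `ℝ` centred at `0`: `1` on `|s| ≤ rIn`. [folklore] -/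
theorem bump_eq_one {f : ContDiffBump (0 : ℝ)} {s : ℝ} (hs : |s| ≤ f.rIn) : f s = 1 :=
  f.one_of_mem_closedBall (by rwa [mem_closedBall, dist_zero_right, Real.norm_eq_abs])

/-- Values of a bump on `ℝ` centred at `0`: `0` on `rOut ≤ |s|`. [folklore] -/
theorem bump_eq_zero {f : ContDiffBump (0 : ℝ)} {s : ℝ} (hs : f.rOut ≤ |s|) : f s = 0 :=
  f.zero_of_le_dist (by rwa [dist_zero_right, Real.norm_eq_abs])

/-- **The smoothed graph function** `ĝ = χ₂ • g`, globally `C^∞` and equal to `g` on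
`|s| ≤ a/2`. [folklore] -/
def gHat (s : ℝ) : 𝔼 3 := S.χ₂ s • A.g s

/-- `ĝ = g` on `|s| ≤ a/2`. [folklore] -/
theorem gHat_eq {s : ℝ} (hs : |s| ≤ S.a / 2) : S.gHat s = A.g s := by
  rw [gHat, bump_eq_one (by exact hs), one_smul]

/-- `ĝ = 0` on `3a/4 ≤ |s|`. [folklore] -/
theorem gHat_eq_zero {s : ℝ} (hs : 3 * S.a / 4 ≤ |s|) : S.gHat s = 0 := by
  rw [gHat, bump_eq_zero (by exact hs), zero_smul]

/-- The smoothed graph function is `C^∞`. [folklore] -/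
theorem contDiff_gHat : ContDiff ℝ ∞ S.gHat := by
  rw [contDiff_iff_contDiffAt]
  intro s
  by_cases hs : |s| < A.r
  · exact (S.χ₂.contDiff.contDiffAt).smul (A.contDiffAt_g hs)
  · -- far out `ĝ` vanishes identically near `s`
    have hfar : ∀ᶠ s' in 𝓝 s, S.gHat s' = 0 := by
      have h34 : 3 * S.a / 4 < A.r := by linarith [S.a_le, S.a_pos, A.r_pos]
      have ho : IsOpen {s' : ℝ | 3 * S.a / 4 < |s'|} := isOpen_lt continuous_const continuous_abs
      filter_upwards [ho.mem_nhds (show 3 * S.a / 4 < |s| by push Not at hs; linarith)] with s' hs'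
      exact S.gHat_eq_zero hs'.le
    exact contDiffAt_const.congr_of_eventuallyEq hfar

/-- `ĝ ⊥ e`. [folklore] -/
theorem inner_gHat_e (s : ℝ) : ⟪S.gHat s, A.e⟫ = 0 := by
  by_cases hs : |s| < A.r
  · rw [gHat, inner_smul_left, A.inner_g_e hs, mul_zero]
  · rw [S.gHat_eq_zero (by push Not at hs; linarith [S.a_le, A.r_pos]), inner_zero_left]

/-- `ĝ` has nonnegative height. [folklore] -/
theorem gHat_two_nonneg (s : ℝ) : 0 ≤ S.gHat s 2 := by
  simp only [gHat, PiLp.smul_apply, smul_eq_mul]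
  exact mul_nonneg (S.χ₂.nonneg) (A.g_two_nonneg s)

/-- `ĝ₂ ≤ g₂`. [folklore] -/
theorem gHat_two_le (s : ℝ) : S.gHat s 2 ≤ A.g s 2 := by
  simp only [gHat, PiLp.smul_apply, smul_eq_mul]
  have := A.g_two_nonneg s
  nlinarith [S.χ₂.nonneg (x := s), S.χ₂.le_one (x := s)]

/-- The vertical unit vector `e₂`. [folklore] -/
def up : 𝔼 3 := EuclideanSpace.single 2 1

/-- `⟪e₂, e⟫ = 0`. [folklore] -/
theorem inner_up_e : ⟪up, A.e⟫ = 0 := by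
  rw [up, EuclideanSpace.inner_single_left]
  simp [A.e_two]

/-- **The displacement** `V̂ s = -(b/8) • e₂ - ĝ s` (push the arc down by `b/8` onto its tangent
line). [folklore] -/
def disp (s : ℝ) : 𝔼 3 := -(S.b / 8) • up - S.gHat s

/-- The displacement is orthogonal to the tangent. [folklore] -/
theorem inner_disp_e (s : ℝ) : ⟪S.disp s, A.e⟫ = 0 := by
  rw [disp, inner_sub_left, inner_smul_left, inner_up_e, S.inner_gHat_e]
  simp

/-- The displacement is `C^∞`. [folklore] -/
theorem contDiff_disp : ContDiff ℝ ∞ S.disp := contDiff_const.sub S.contDiff_gHat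

/-- Size of the displacement on `|s| ≤ a`: at most `b/4`. [folklore] -/
theorem norm_disp_le {s : ℝ} (hs : |s| ≤ S.a) : ‖S.disp s‖ ≤ S.b / 4 := by
  have h1 : ‖-(S.b / 8) • up‖ = S.b / 8 := by
    rw [norm_smul, norm_neg, Real.norm_eq_abs, abs_of_pos (by linarith [S.b_pos]), up,
      PiLp.norm_single, norm_one, mul_one]
  have h2 : ‖S.gHat s‖ ≤ S.b / 8 := by
    rw [gHat, norm_smul, Real.norm_eq_abs, abs_of_nonneg S.χ₂.nonneg]
    exact (mul_le_of_le_one_left (norm_nonneg _) S.χ₂.le_one).trans (S.g_small s hs)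
  calc ‖S.disp s‖ ≤ ‖-(S.b / 8) • up‖ + ‖S.gHat s‖ := norm_sub_le _ _
    _ ≤ S.b / 4 := by rw [h1]; linarith

/-- The deviation of a point of `ℝ³` from the smoothed graph. [folklore] -/
def yOf (z : 𝔼 3) : 𝔼 3 := z - A.p - A.sOf z • A.e - S.gHat (A.sOf z)

/-- **The flattening field** `Y z = χ (s z) ψ (‖ŷ z‖²) • V̂ (s z)`. [folklore] -/
def field (z : 𝔼 3) : 𝔼 3 := (S.χ (A.sOf z) * S.ψ (‖S.yOf z‖ ^ 2)) • S.disp (A.sOf z)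

/-- The deviation of a point is `C^∞`. [folklore] -/
theorem contDiff_yOf : ContDiff ℝ ∞ S.yOf :=
  ((contDiff_id.sub contDiff_const).sub (A.contDiff_sOf.smul contDiff_const)).sub
    (S.contDiff_gHat.comp A.contDiff_sOf)

/-- The flattening field is `C^∞`. [folklore] -/
theorem contDiff_field : ContDiff ℝ ∞ S.field :=
  ((S.χ.contDiff.comp A.contDiff_sOf).mul (S.ψ.contDiff.comp (S.contDiff_yOf.norm_sq ℝ))).smul
    (S.contDiff_disp.comp A.contDiff_sOf)

/-- Moving along the displacement does not change the tangent coordinate. [folklore] -/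
theorem sOf_add_smul_disp (z : 𝔼 3) (c s : ℝ) : A.sOf (z + c • S.disp s) = A.sOf z := by
  rw [sOf, sOf, add_sub_right_comm, inner_add_left, inner_smul_left, S.inner_disp_e]
  simp

/-- Moving along the displacement of its own tangent coordinate translates the deviation.
[folklore] -/
theorem yOf_add_smul_disp (z : 𝔼 3) (c : ℝ) :
    S.yOf (z + c • S.disp (A.sOf z)) = S.yOf z + c • S.disp (A.sOf z) := by
  rw [yOf, yOf, S.sOf_add_smul_disp]
  abel

/-! ### The curves of the knot points -/

/-- The weight `μ θ = χ (σ θ) ψ (‖ŷ (chartCurve θ)‖²) ∈ [0, 1]` with which the knot point over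
`θ` moves. [folklore] -/
def μ (θ : ℝ) : ℝ := S.χ (A.σ θ) * S.ψ (‖S.yOf (K.chartCurve θ)‖ ^ 2)

/-- `0 ≤ μ`. [folklore] -/
theorem μ_nonneg (θ : ℝ) : 0 ≤ S.μ θ := mul_nonneg S.χ.nonneg S.ψ.nonneg

/-- `μ ≤ 1`. [folklore] -/
theorem μ_le_one (θ : ℝ) : S.μ θ ≤ 1 :=
  mul_le_one₀ S.χ.le_one S.ψ.nonneg S.ψ.le_one

/-- **The curve of the knot point over `θ`**: the straight segment
`t ↦ chartCurve θ + (t μ θ) • V̂ (σ θ)`. [folklore] -/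
def curve (θ t : ℝ) : 𝔼 3 := K.chartCurve θ + (t * S.μ θ) • S.disp (A.σ θ)

/-- The curves start on the knot. [folklore] -/
theorem curve_zero (θ : ℝ) : S.curve θ 0 = K.chartCurve θ := by simp [curve]

/-- The curves are `2π`-periodic in `θ`. [folklore] -/
theorem curve_add_two_pi (θ t : ℝ) : S.curve (θ + 2 * Real.pi) t = S.curve θ t := by
  simp only [curve, μ, σ, K.periodic_chartCurve θ, periodic_sCoord A.θ₀ θ]

/-- The field at a knot point. [folklore] -/
theorem field_chartCurve (θ : ℝ) : S.field (K.chartCurve θ) = S.μ θ • S.disp (A.σ θ) := rfl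

/-- **A moving knot point lies on the window arc** (modulo the period): if `μ θ ≠ 0` then some
translate `θ' = θ - 2πm` lies in the window with `|σ θ'| < a/2`, and there the deviation from the
graph vanishes. [folklore] -/
theorem exists_window_of_μ_ne_zero {θ : ℝ} (h : S.μ θ ≠ 0) :
    ∃ θ' ∈ Ioo (A.θ₀ - A.w) (A.θ₀ + A.w), (∃ m : ℤ, θ' = θ - m * (2 * Real.pi)) ∧
      |A.σ θ'| < S.a / 2 ∧ S.yOf (K.chartCurve θ') = 0 ∧ K.chartCurve θ' = K.chartCurve θ ∧
      A.σ θ' = A.σ θ := by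
  have hχ : S.χ (A.σ θ) ≠ 0 := left_ne_zero_of_mul h
  have hψ : S.ψ (‖S.yOf (K.chartCurve θ)‖ ^ 2) ≠ 0 := right_ne_zero_of_mul h
  have hσ : |A.σ θ| < S.a / 2 := by
    by_contra hle
    exact hχ (bump_eq_zero (by push Not at hle; exact hle))
  have hy : ‖S.yOf (K.chartCurve θ)‖ < 3 * S.b / 4 := by
    by_contra hle
    push Not at hle
    refine hψ (bump_eq_zero ?_)
    change (3 * S.b / 4) ^ 2 ≤ |‖S.yOf (K.chartCurve θ)‖ ^ 2|
    rw [abs_of_nonneg (sq_nonneg _)]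
    exact pow_le_pow_left₀ (by linarith [S.b_pos]) hle 2
  -- reduce `θ` into the half-open period `(θ₀ - w, θ₀ + 2π - w]`
  obtain ⟨m, hm1, hm2⟩ : ∃ m : ℤ, A.θ₀ - A.w < θ - m * (2 * Real.pi) ∧
      θ - m * (2 * Real.pi) ≤ A.θ₀ + 2 * Real.pi - A.w := by
    obtain ⟨m, hm, -⟩ := existsUnique_sub_zsmul_mem_Ioc (by positivity : (0 : ℝ) < 2 * Real.pi)
      θ (A.θ₀ - A.w)
    rw [zsmul_eq_mul] at hm
    exact ⟨m, hm.1, by linarith [hm.2]⟩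
  set θ' := θ - m * (2 * Real.pi) with hθ'
  have hcc : K.chartCurve θ' = K.chartCurve θ := by
    have := (K.periodic_chartCurve.int_mul (-m)) θ
    rw [← this]; congr 1; push_cast; ring
  have hσσ : A.σ θ' = A.σ θ := by
    have := ((periodic_sCoord (K := K) A.θ₀).int_mul (-m)) θ
    change K.sCoord A.θ₀ θ' = K.sCoord A.θ₀ θ
    rw [← this]; congr 1; push_cast; ring
  -- `θ'` cannot be far: the far strands are `b`-separated from the graph
  have hwin : θ' < A.θ₀ + A.w := by
    by_contra hge
    push Not at hge
    have hsep := S.sep θ' ⟨hge, hm2⟩ (by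
      rw [hσσ]; have := abs_nonneg (A.σ θ); linarith [hσ.le, S.a_le, A.r_pos])
    have hdev : A.dev θ' = S.yOf (K.chartCurve θ) := by
      rw [dev, yOf, sOf_chartCurve, hcc, hσσ, S.gHat_eq hσ.le]
    rw [hdev] at hsep
    linarith [S.b_pos]
  refine ⟨θ', ⟨hm1, hwin⟩, ⟨m, rfl⟩, by rwa [hσσ], ?_, hcc, hσσ⟩
  rw [yOf, sOf_chartCurve, A.chartCurve_eq ⟨hm1, hwin⟩, S.gHat_eq (by rw [hσσ]; exact hσ.le)]
  abel

/-- If `μ θ ≠ 0` then the knot point over `θ` lies on the graph: `ŷ = 0`, hence `μ θ = χ (σ θ)`.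
[folklore] -/
theorem μ_eq_of_ne_zero {θ : ℝ} (h : S.μ θ ≠ 0) :
    S.yOf (K.chartCurve θ) = 0 ∧ S.μ θ = S.χ (A.σ θ) ∧ |A.σ θ| < S.a / 2 ∧
      K.chartCurve θ = A.p + A.σ θ • A.e + A.g (A.σ θ) := by
  obtain ⟨θ', hθ', -, hσ', hy, hcc, hσσ⟩ := S.exists_window_of_μ_ne_zero h
  have hy' : S.yOf (K.chartCurve θ) = 0 := by rwa [hcc] at hy
  refine ⟨hy', ?_, by rwa [hσσ] at hσ', ?_⟩
  · rw [μ, hy', norm_zero, zero_pow two_ne_zero, bump_eq_one (f := S.ψ) (by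
      rw [abs_zero]; exact le_of_lt (by have := S.b_pos; change (0:ℝ) < (S.b/2)^2; positivity)),
      mul_one]
  · rw [← hcc, ← hσσ]
    exact A.chartCurve_eq hθ'

/-- **The curves solve the flattening field.** [folklore] -/
theorem hasDerivAt_curve (θ : ℝ) {t : ℝ} (ht : t ∈ Ioo (-1 : ℝ) 2) :
    HasDerivAt (S.curve θ) (S.field (S.curve θ t)) t := by
  -- the curve is a straight segment with velocity `μ θ • V̂ (σ θ)`
  have hd : HasDerivAt (S.curve θ) (S.μ θ • S.disp (A.σ θ)) t := by
    have h1 : HasDerivAt (fun t : ℝ ↦ t * S.μ θ) (S.μ θ) t := by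
      simpa using (hasDerivAt_id t).mul_const (S.μ θ)
    have h2 := h1.smul_const (S.disp (A.σ θ))
    exact h2.const_add _
  suffices hY : S.field (S.curve θ t) = S.μ θ • S.disp (A.σ θ) by rwa [hY]
  by_cases hμ : S.μ θ = 0
  · -- stationary points
    have hc : S.curve θ t = K.chartCurve θ := by simp [curve, hμ]
    rw [hc, field_chartCurve]
  · -- moving points lie on the graph and stay within `b/2` of it
    obtain ⟨hy, hμχ, hσ, -⟩ := S.μ_eq_of_ne_zero hμ
    have hs : A.sOf (S.curve θ t) = A.σ θ := by
      rw [curve, S.sOf_add_smul_disp, sOf_chartCurve]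
    have hyt : S.yOf (S.curve θ t) = (t * S.μ θ) • S.disp (A.σ θ) := by
      rw [curve, ← A.sOf_chartCurve θ, S.yOf_add_smul_disp, sOf_chartCurve, hy, zero_add]
    have hsmall : ‖S.yOf (S.curve θ t)‖ ≤ S.b / 2 := by
      rw [hyt, norm_smul, Real.norm_eq_abs, abs_mul]
      have h1 : |t| ≤ 2 := abs_le.2 ⟨by linarith [ht.1], ht.2.le⟩
      have h2 : |S.μ θ| ≤ 1 := by rw [abs_of_nonneg (S.μ_nonneg θ)]; exact S.μ_le_one θ
      have h3 := S.norm_disp_le (s := A.σ θ) (by linarith [hσ.le, S.a_pos])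
      calc |t| * |S.μ θ| * ‖S.disp (A.σ θ)‖ ≤ 2 * 1 * (S.b / 4) := by gcongr
        _ = S.b / 2 := by ring
    have hψ1 : S.ψ (‖S.yOf (S.curve θ t)‖ ^ 2) = 1 := by
      refine bump_eq_one ?_
      change |‖S.yOf (S.curve θ t)‖ ^ 2| ≤ (S.b / 2) ^ 2
      rw [abs_of_nonneg (sq_nonneg _)]
      exact pow_le_pow_left₀ (norm_nonneg _) hsmall 2
    rw [field, hs, hψ1, mul_one, hμχ]

/-- The curves, jointly continuous. [folklore] -/
theorem continuous_curve : Continuous fun q : ℝ × ℝ ↦ S.curve q.1 q.2 := by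
  have hcc := continuous_chartCurve A.ne_southPole
  have hσ : Continuous A.σ := (contDiff_sCoord A.ne_southPole A.θ₀).continuous
  have hμ : Continuous S.μ := by
    unfold μ
    exact (S.χ.continuous.comp hσ).mul
      (S.ψ.continuous.comp (((S.contDiff_yOf.continuous.comp hcc).norm).pow 2))
  have h1 : Continuous fun q : ℝ × ℝ ↦ (q.2 * S.μ q.1) • S.disp (A.σ q.1) :=
    (continuous_snd.mul (hμ.comp continuous_fst)).smul
      (S.contDiff_disp.continuous.comp (hσ.comp continuous_fst))
  exact (hcc.comp continuous_fst).add h1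

/-- All curves stay in one compact set during times `[-1, 2]`. [folklore] -/
theorem exists_isCompact_curve_mem : ∃ C : Set (𝔼 3), IsCompact C ∧
    ∀ θ, ∀ t ∈ Ioo (-1 : ℝ) 2, S.curve θ t ∈ C := by
  refine ⟨(fun q : ℝ × ℝ ↦ S.curve q.1 q.2) '' (Icc (0 : ℝ) (2 * Real.pi) ×ˢ Icc (-1 : ℝ) 2),
    (isCompact_Icc.prod isCompact_Icc).image S.continuous_curve, fun θ t ht ↦ ?_⟩
  -- reduce `θ` into the period
  obtain ⟨m, hm⟩ : ∃ m : ℤ, θ - m * (2 * Real.pi) ∈ Icc (0 : ℝ) (2 * Real.pi) := by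
    have h2 : (0 : ℝ) < 2 * Real.pi := by positivity
    refine ⟨⌊θ / (2 * Real.pi)⌋, ?_, ?_⟩
    · have := Int.floor_le (θ / (2 * Real.pi))
      rw [le_div_iff₀ h2] at this
      linarith
    · have := Int.lt_floor_add_one (θ / (2 * Real.pi))
      rw [div_lt_iff₀ h2] at this
      nlinarith
  refine ⟨(θ - m * (2 * Real.pi), t), mk_mem_prod hm ⟨ht.1.le, ht.2.le⟩, ?_⟩
  have hp : Periodic (fun θ ↦ S.curve θ t) (2 * Real.pi) := fun θ ↦ S.curve_add_two_pi θ t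
  have := (hp.int_mul (-m)) θ
  simp only at this ⊢
  rw [← this]
  congr 1
  push_cast
  ring

/-! ### The flattened knot -/

/-- The new base point `p̂ = p - (b/8) • e₂` (the centre of the flat arc). [folklore] -/
def pHat : 𝔼 3 := A.p - (S.b / 8) • up

/-- Height of the new base point. [folklore] -/
theorem pHat_two : S.pHat 2 = A.p 2 - S.b / 8 := by
  simp [pHat, up]

/-- `⟪z - p̂, e⟫ = ⟪z - p, e⟫`. [folklore] -/
theorem inner_sub_pHat (z : 𝔼 3) : ⟪z - S.pHat, A.e⟫ = A.sOf z := by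
  rw [pHat, sOf, show z - (A.p - (S.b / 8) • up) = (z - A.p) + (S.b / 8) • up by abel,
    inner_add_left, inner_smul_left, inner_up_e]
  simp

/-- **On the core of the window the end point of the curve is on the flat segment**:
`curve θ 1 = p̂ + σ θ • e` when `|σ θ| ≤ a/4`. [folklore] -/
theorem curve_one_eq {θ : ℝ} (hθ : θ ∈ Ioo (A.θ₀ - A.w) (A.θ₀ + A.w)) (hσ : |A.σ θ| ≤ S.a / 4) :
    S.curve θ 1 = S.pHat + A.σ θ • A.e := by
  have ha := S.a_pos
  have hcc := A.chartCurve_eq hθ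
  have hg : S.gHat (A.σ θ) = A.g (A.σ θ) := S.gHat_eq (by linarith)
  have hy : S.yOf (K.chartCurve θ) = 0 := by
    rw [yOf, sOf_chartCurve, hcc, hg]; abel
  have hμ : S.μ θ = 1 := by
    rw [μ, hy, norm_zero, zero_pow two_ne_zero, bump_eq_one (f := S.χ) (by exact hσ),
      bump_eq_one (f := S.ψ) (by rw [abs_zero]; change (0 : ℝ) ≤ (S.b / 2) ^ 2; positivity)]
    ring
  rw [curve, hμ, hcc, disp, hg, pHat]
  simp only [mul_one, one_smul, neg_smul]
  abel

/-- **The height of the end points**: `p̂₂ ≤ (curve θ 1)₂` for every `θ`. [folklore] -/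
theorem pHat_two_le_curve_one (θ : ℝ) : S.pHat 2 ≤ S.curve θ 1 2 := by
  rw [pHat_two]
  have hmin : A.p 2 ≤ K.chartCurve θ 2 := A.isMin θ
  by_cases hμ : S.μ θ = 0
  · have : S.curve θ 1 = K.chartCurve θ := by simp [curve, hμ]
    rw [this]; linarith [S.b_pos]
  · obtain ⟨-, -, hσ, hcc⟩ := S.μ_eq_of_ne_zero hμ
    have hg : S.gHat (A.σ θ) = A.g (A.σ θ) := S.gHat_eq hσ.le
    have h2 : S.curve θ 1 2 = A.p 2 - S.μ θ * (S.b / 8) + (1 - S.μ θ) * A.g (A.σ θ) 2 := by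
      rw [curve, hcc, disp, hg]
      simp [A.e_two, up]
      ring
    rw [h2]
    have := S.μ_nonneg θ
    have := S.μ_le_one θ
    have := A.g_two_nonneg (A.σ θ)
    nlinarith [S.b_pos]

/-- **The box is clean**: an end point with tangent coordinate `< a/4` in absolute value and
height `< p₂` lies on the flat segment. [folklore] -/
theorem curve_one_eq_of_lt {θ : ℝ} (h1 : |A.sOf (S.curve θ 1)| < S.a / 4)
    (h2 : S.curve θ 1 2 < A.p 2) : ∃ s ∈ Icc (-(S.a / 4)) (S.a / 4), S.curve θ 1 = S.pHat + s • A.e := by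
  have hμ : S.μ θ ≠ 0 := by
    intro hμ
    have : S.curve θ 1 = K.chartCurve θ := by simp [curve, hμ]
    rw [this] at h2
    linarith [show A.p 2 ≤ K.chartCurve θ 2 from A.isMin θ]
  obtain ⟨θ', hθ', ⟨m, hm⟩, hσ', -, hcc, hσσ⟩ := S.exists_window_of_μ_ne_zero hμ
  have hcurve : S.curve θ' 1 = S.curve θ 1 := by
    have hp : Periodic (fun θ ↦ S.curve θ 1) (2 * Real.pi) := fun θ ↦ S.curve_add_two_pi θ 1
    have := (hp.int_mul (-m)) θ
    rw [← this, hm]; congr 1; push_cast; ring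
  have hs : A.sOf (S.curve θ 1) = A.σ θ := by
    rw [curve, S.sOf_add_smul_disp, sOf_chartCurve]
  rw [hs, ← hσσ] at h1
  refine ⟨A.σ θ', ⟨by linarith [(abs_lt.1 h1).1], (abs_lt.1 h1).2.le⟩, ?_⟩
  rw [← hcurve]
  exact S.curve_one_eq hθ' h1.le

/-- **The flattening isotopy of `ℝ³`** realising the curves (cut-off and integration of the
flattening field, `exists_ambientIsotopy_of_hasDerivAt`). [folklore] -/
theorem exists_ambientIsotopy_curve : ∃ G : AmbientIsotopy 𝓘(ℝ, 𝔼 3) (𝔼 3),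
    (∃ R : ℝ, ∀ t z, R ≤ ‖z‖ → G.toFun t z = z) ∧
      ∀ θ, ∀ t ∈ Icc (0 : ℝ) 1, G.toFun t (K.chartCurve θ) = S.curve θ t := by
  obtain ⟨C, hC, hmem⟩ := S.exists_isCompact_curve_mem
  have hY : ContDiff ℝ ∞ fun q : ℝ × 𝔼 3 ↦ S.field q.2 := S.contDiff_field.comp contDiff_snd
  obtain ⟨G, ⟨C', hC', -, hGC'⟩, hG⟩ := exists_ambientIsotopy_of_hasDerivAt hY (c := S.curve)
    (fun θ t ht ↦ S.hasDerivAt_curve θ ht) hC isOpen_univ (subset_univ _) hmem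
  obtain ⟨R₀, hR₀⟩ := hC'.isBounded.subset_closedBall 0
  refine ⟨G, ⟨R₀ + 1, fun t z hz ↦ hGC' t z fun hzC ↦ ?_⟩, fun θ t ht ↦ ?_⟩
  · have := hR₀ hzC
    rw [mem_closedBall, dist_zero_right] at this
    linarith
  · have := hG θ t ht
    rwa [S.curve_zero] at this

/-- **The flattened knot**: transport the flattening isotopy to `𝕊³` along `ψ`
(`AmbientIsotopy.alongChart`) and take the image of `K`. [folklore] -/
theorem exists_knot : ∃ K' : Knot, K.IsIsotopic K' ∧ (∀ x, K' x ≠ southPole) ∧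
    ∀ θ, psi (K' (circlePoint θ)) = S.curve θ 1 := by
  obtain ⟨G, ⟨R, hR⟩, hG⟩ := S.exists_ambientIsotopy_curve
  set F := G.alongChart (φ := psi) contMDiffOn_psi contMDiff_psi_symm psi_target hR with hF
  refine ⟨K.map (F.toDiffeomorph 1), K.isIsotopic_map F, fun x ↦ ?_, fun θ ↦ ?_⟩
  · change F.toFun 1 (K x) ≠ southPole
    rw [hF, AmbientIsotopy.alongChart_toFun,
      chartTransport_of_mem _ (mem_psi_source (A.ne_southPole x))]
    exact psi_symm_ne_southPole _
  · change psi (F.toFun 1 (K (circlePoint θ))) = S.curve θ 1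
    rw [hF, AmbientIsotopy.alongChart_toFun,
      chartTransport_of_mem _ (mem_psi_source (A.ne_southPole _)), psi_apply_psi_symm,
      ← chartCurve_apply, hG θ 1 ⟨zero_le_one, le_rfl⟩]

end Scales

end ArcFrame

/-- **Every knot is isotopic to a knot with a flat arc.** For every knot `K` there is an ambient
isotopic knot `K'` off the south pole and, in the stereographic chart `ψ` (`KnotsInBall.psi`),
a point `p`, a horizontal unit vector `e` and `ℓ, ν > 0` such that: the straight segment
`{p + s e : |s| ≤ ℓ}` lies on `ψ ∘ K'`; the whole knot lies at height `≥ p₂`; the only points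
of the knot with tangent coordinate `|⟪ψ K' x - p, e⟫| < ℓ` and height `< p₂ + ν` are the points
of the segment; and `K'` traverses the segment regularly (at `p` its chart velocity is a positive
multiple of `e`). Construction: move `K` off the south pole (homogeneity); at a lowest point of
`ψ ∘ K` the knot is a graph over its horizontal tangent line (inverse function theorem); push
the graph down onto the line `p₂ = min - ν` by the flow of a cut-off vertical field (Hirsch,
Ch. 8 §1, Thms. 1.3–1.4, through `exists_ambientIsotopy_of_hasDerivAt`) and transport the
isotopy to `𝕊³`. (Used to attach a band to a prescribed straight arc of a copy of the knot.)
[cite: HirschDT1976, Ch. 8 §1, Thm. 1.3] -/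
theorem exists_flatArc (K : Knot) : ∃ K' : Knot, K.IsIsotopic K' ∧ (∀ x, K' x ≠ southPole) ∧
    ∃ (p e : 𝔼 3) (ℓ ν : ℝ), ‖e‖ = 1 ∧ e 2 = 0 ∧ 0 < ℓ ∧ 0 < ν ∧
      (∀ s ∈ Icc (-ℓ) ℓ, ∃ θ : ℝ, psi (K' (circlePoint θ)) = p + s • e) ∧
      (∀ x, p 2 ≤ psi (K' x) 2) ∧
      (∀ x, |⟪psi (K' x) - p, e⟫| < ℓ → psi (K' x) 2 < p 2 + ν →
        ∃ s ∈ Icc (-ℓ) ℓ, psi (K' x) = p + s • e) ∧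
      (∃ θ c : ℝ, 0 < c ∧ psi (K' (circlePoint θ)) = p ∧
        deriv (fun t ↦ psi (K' (circlePoint t))) θ = c • e) := by
  obtain ⟨K₀, hKK₀, hK₀⟩ := K.exists_isIsotopic_forall_ne southPole
  obtain ⟨A⟩ := nonempty_arcFrame hK₀
  obtain ⟨S⟩ := A.nonempty_scales
  obtain ⟨K', hK₀K', hK', hcurve⟩ := S.exists_knot
  have ha := S.a_pos
  have hb := S.b_pos
  refine ⟨K', SphereEmbedding.IsIsotopic.trans_holds hKK₀ hK₀K', hK', S.pHat, A.e, S.a / 4,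
    S.b / 8, A.norm_e, A.e_two, by linarith, by linarith, ?_, ?_, ?_, ?_⟩
  · -- the flat segment lies on the knot
    intro s hs
    have hs' : |s| ≤ S.a / 4 := abs_le.2 ⟨hs.1, hs.2⟩
    have hsr : |s| < A.r := by linarith [S.a_le, A.r_pos]
    refine ⟨A.τ s, ?_⟩
    rw [hcurve, S.curve_one_eq (A.τ_mem s hsr) (by rw [show A.σ (A.τ s) = s from A.sCoord_τ s hsr]; exact hs'),
      show A.σ (A.τ s) = s from A.sCoord_τ s hsr]
  · -- heights
    intro x
    obtain ⟨θ, rfl⟩ := circlePoint_surjective x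
    rw [hcurve]
    exact S.pHat_two_le_curve_one θ
  · -- the box is clean
    intro x h1 h2
    obtain ⟨θ, rfl⟩ := circlePoint_surjective x
    rw [hcurve] at h1 h2 ⊢
    rw [S.inner_sub_pHat] at h1
    rw [S.pHat_two] at h2
    exact S.curve_one_eq_of_lt h1 (by linarith)
  · -- the knot traverses the segment regularly
    refine ⟨A.θ₀, deriv A.σ A.θ₀, ?_, ?_, ?_⟩
    · change 0 < deriv (K₀.sCoord A.θ₀) A.θ₀
      rw [deriv_sCoord_self hK₀]
      exact norm_pos_iff.2 (deriv_chartCurve_ne_zero hK₀ _)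
    · rw [hcurve, S.curve_one_eq ⟨by linarith [A.w_pos], by linarith [A.w_pos]⟩
        (by rw [show A.σ A.θ₀ = 0 from sCoord_self A.θ₀, abs_zero]; linarith),
        show A.σ A.θ₀ = 0 from sCoord_self A.θ₀, zero_smul, add_zero]
    · -- near `θ₀` the chart curve of `K'` is the affine segment `p̂ + σ • e`
      have hσc : Continuous A.σ := (contDiff_sCoord hK₀ A.θ₀).continuous
      have hev : (fun t ↦ psi (K' (circlePoint t))) =ᶠ[𝓝 A.θ₀] fun t ↦ S.pHat + A.σ t • A.e := by
        have ho : IsOpen (Ioo (A.θ₀ - A.w) (A.θ₀ + A.w) ∩ {t | |A.σ t| < S.a / 4}) :=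
          isOpen_Ioo.inter (isOpen_lt (continuous_abs.comp hσc) continuous_const)
        have hmem : A.θ₀ ∈ Ioo (A.θ₀ - A.w) (A.θ₀ + A.w) ∩ {t | |A.σ t| < S.a / 4} := by
          refine ⟨⟨by linarith [A.w_pos], by linarith [A.w_pos]⟩, ?_⟩
          change |A.σ A.θ₀| < S.a / 4
          rw [show A.σ A.θ₀ = 0 from sCoord_self A.θ₀, abs_zero]; linarith
        filter_upwards [ho.mem_nhds hmem] with t ht
        rw [hcurve]
        exact S.curve_one_eq ht.1 (le_of_lt ht.2)
      rw [hev.deriv_eq]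
      have hd : HasDerivAt (fun t ↦ S.pHat + A.σ t • A.e) (deriv A.σ A.θ₀ • A.e) A.θ₀ :=
        ((hasDerivAt_sCoord hK₀ A.θ₀ A.θ₀).deriv ▸
          (hasDerivAt_sCoord hK₀ A.θ₀ A.θ₀).smul_const A.e).const_add _
      exact hd.deriv

/-- **Parametrised form of the flat arc.** As `exists_flatArc`, with the traversal of the
segment made explicit: there are parameters `α < θ₁ < β` and a `C^∞` function `σ : ℝ → ℝ` with
positive derivative on `(α, β)`, `σ θ₁ = 0`, `σ α = -ℓ`, `σ β = ℓ`, such that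
`ψ (K' (cos θ, sin θ)) = p + σ θ • e` for all `θ ∈ [α, β]` (so the segment is traversed exactly
once, regularly, over `[α, β]`). [cite: HirschDT1976, Ch. 8 §1, Thm. 1.3] -/
theorem exists_flatArc_param (K : Knot) : ∃ K' : Knot, K.IsIsotopic K' ∧ (∀ x, K' x ≠ southPole) ∧
    ∃ (p e : 𝔼 3) (ℓ ν : ℝ), ‖e‖ = 1 ∧ e 2 = 0 ∧ 0 < ℓ ∧ 0 < ν ∧
      (∀ x, p 2 ≤ psi (K' x) 2) ∧
      (∀ x, |⟪psi (K' x) - p, e⟫| < ℓ → psi (K' x) 2 < p 2 + ν →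
        ∃ s ∈ Icc (-ℓ) ℓ, psi (K' x) = p + s • e) ∧
      ∃ (α θ₁ β : ℝ) (σ : ℝ → ℝ), α < θ₁ ∧ θ₁ < β ∧ β < α + 2 * Real.pi ∧ ContDiff ℝ ∞ σ ∧
        (∀ θ ∈ Icc α β, 0 < deriv σ θ) ∧ σ θ₁ = 0 ∧ σ α = -ℓ ∧ σ β = ℓ ∧
        ∀ θ ∈ Icc α β, psi (K' (circlePoint θ)) = p + σ θ • e := by
  obtain ⟨K₀, hKK₀, hK₀⟩ := K.exists_isIsotopic_forall_ne southPole
  obtain ⟨A⟩ := nonempty_arcFrame hK₀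
  obtain ⟨S⟩ := A.nonempty_scales
  obtain ⟨K', hK₀K', hK', hcurve⟩ := S.exists_knot
  have ha := S.a_pos
  have hb := S.b_pos
  have har : S.a / 4 < A.r := by linarith [S.a_le, A.r_pos]
  refine ⟨K', SphereEmbedding.IsIsotopic.trans_holds hKK₀ hK₀K', hK', S.pHat, A.e, S.a / 4,
    S.b / 8, A.norm_e, A.e_two, by linarith, by linarith, ?_, ?_, ?_⟩
  · intro x
    obtain ⟨θ, rfl⟩ := circlePoint_surjective x
    rw [hcurve]
    exact S.pHat_two_le_curve_one θ
  · intro x h1 h2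
    obtain ⟨θ, rfl⟩ := circlePoint_surjective x
    rw [hcurve] at h1 h2 ⊢
    rw [S.inner_sub_pHat] at h1
    rw [S.pHat_two] at h2
    exact S.curve_one_eq_of_lt h1 (by linarith)
  · -- the parametrisation of the segment by `σ` over `[τ (-a/4), τ (a/4)]`
    have hm : ∀ s, |s| ≤ S.a / 4 → A.τ s ∈ Ioo (A.θ₀ - A.w) (A.θ₀ + A.w) ∧ A.σ (A.τ s) = s :=
      fun s hs ↦ ⟨A.τ_mem s (by linarith), A.sCoord_τ s (by linarith)⟩
    have hτ0 : A.τ 0 = A.θ₀ := by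
      have h := A.τ_sCoord A.θ₀ ⟨by linarith [A.w_pos], by linarith [A.w_pos]⟩
      rwa [sCoord_self] at h
    -- `σ` is strictly increasing on the window
    have hmono : StrictMonoOn A.σ (Ioo (A.θ₀ - A.w) (A.θ₀ + A.w)) :=
      strictMonoOn_of_deriv_pos (convex_Ioo _ _)
        ((contDiff_sCoord hK₀ A.θ₀).continuous.continuousOn) fun θ hθ ↦
          A.deriv_pos θ (by rwa [interior_Ioo] at hθ)
    obtain ⟨hαm, hασ⟩ := hm (-(S.a / 4)) (by rw [abs_neg, abs_of_pos (by linarith)])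
    obtain ⟨hβm, hβσ⟩ := hm (S.a / 4) (by rw [abs_of_pos (by linarith)])
    have hθ₀m : A.θ₀ ∈ Ioo (A.θ₀ - A.w) (A.θ₀ + A.w) := ⟨by linarith [A.w_pos], by linarith [A.w_pos]⟩
    have hσ0 : A.σ A.θ₀ = 0 := sCoord_self A.θ₀
    have hαθ : A.τ (-(S.a / 4)) < A.θ₀ := by
      by_contra hle; push Not at hle
      have := hmono.monotoneOn hθ₀m hαm hle
      rw [hασ, hσ0] at this; linarith
    have hθβ : A.θ₀ < A.τ (S.a / 4) := by
      by_contra hle; push Not at hle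
      have := hmono.monotoneOn hβm hθ₀m hle
      rw [hβσ, hσ0] at this; linarith
    have hsub : Icc (A.τ (-(S.a / 4))) (A.τ (S.a / 4)) ⊆ Ioo (A.θ₀ - A.w) (A.θ₀ + A.w) :=
      fun θ hθ ↦ ⟨lt_of_lt_of_le hαm.1 hθ.1, lt_of_le_of_lt hθ.2 hβm.2⟩
    refine ⟨A.τ (-(S.a / 4)), A.θ₀, A.τ (S.a / 4), A.σ, hαθ, hθβ, ?_,
      contDiff_sCoord hK₀ A.θ₀, fun θ hθ ↦ A.deriv_pos θ (hsub hθ), hσ0, hασ, hβσ, fun θ hθ ↦ ?_⟩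
    · linarith [hαm.1, hβm.2, A.w_le, Real.pi_gt_three]
    · -- on `[α, β]`: window and `|σ| ≤ a/4`
      have hθw := hsub hθ
      have hσle : |A.σ θ| ≤ S.a / 4 := by
        rw [abs_le]
        constructor
        · rw [← hασ]; exact hmono.monotoneOn hαm hθw hθ.1
        · rw [← hβσ]; exact hmono.monotoneOn hθw hβm hθ.2
      rw [hcurve]
      exact S.curve_one_eq hθw hσle

end Knot

end Literature.Topology.FourManifolds
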